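import Mathlib.Analysis.SpecialFunctions.Bernstein
import Mathlib.Algebra.BigOperators.Ring.Finset
import Mathlib.Algebra.Order.BigOperators.Group.Finset
import HarnessLib

/-!
# Range enclosure by tensor-product Bernstein coefficients (Cargo–Shisha 1966; Garloff 1986, §2)

Topic `Literature/Computation/Certificates` (joins `CovarianceBoxCertificate.lean`, whose floor over a parameter
box is computed by the reader `boxdual.reader` as the least tensor-product Bernstein coefficient of the weight
polynomial over a branch-and-bound partition of `[0,1]^κ` — floors F2/F3 of `HOME/hubbard-box-eng-3/BOXDUAL-FORMAT.md`).
Everything is PROVED; no named fact, no number.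

Setting. On the unit box `[0,1]^κ` (`κ` a finite index type, `x : κ → unitInterval`) and for degrees
`n : κ → ℕ`, the TENSOR-PRODUCT BERNSTEIN WEIGHTS are `W_I(x) = Π_j B_{n_j, I_j}(x_j)`,
`I : (j : κ) → Fin (n j + 1)`, with Mathlib's `bernstein n ν : C(I, ℝ)`, `B_{n,ν}(t) = (n choose ν) t^ν (1-t)^{n-ν}`.
They are nonnegative (`bernstein_nonneg`) and sum to one (`bernstein.probability` on each axis, multiplied out by
`Fintype.prod_sum`). Hence a polynomial written in tensor Bernstein form `p(x) = Σ_I b_I W_I(x)` is, at every point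
of the box, a convex combination of its coefficients: `min_I b_I ≤ p(x) ≤ max_I b_I` and `|p(x)| ≤ max_I |b_I|`
(the range-enclosure property; Garloff 1986 §2, going back to Cargo–Shisha 1966 in one variable). The last section
states the form a certificate reader uses: a function `f` on a set `S` covered by LEAVES, on each of which `f` is
represented (after an affine reparametrisation `φ_ℓ : X → [0,1]^κ`, supplied by the caller) by a tensor Bernstein
form with coefficients `b_ℓ`; then `f ≥ m` on `S` as soon as every coefficient of every leaf is `≥ m`
(branch-and-bound by subdivision: de Casteljau's algorithm produces the leaf coefficients; that they represent the
same polynomial is an exact identity checked by the reader, entering here as the hypothesis `hrep`).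

* `weight_nonneg`, `sum_weight_eq_one` — the weights `W_J(x) = Π_j bernstein (n j) (J j) (x j)` form a partition
  of unity on the box (no new definition: weights and forms are written out as `Finset` products / sums);
* `le_form_of_forall_le` / `form_le_of_forall_le` / `abs_form_le_of_forall_abs_le` / `form_mono` — the enclosure
  `min b ≤ Σ_J b_J W_J(x) ≤ max b`, `|Σ_J b_J W_J(x)| ≤ max |b|`; `form_const` — constants have all coefficients equal;
* `le_of_leafRepresentation` — the branch-and-bound floor: leaves covering `S`, per-leaf representations,
  all leaf coefficients `≥ m` ⇒ `m ≤ f` on `S`; `abs_le_of_leafRepresentation` likewise for `|f| ≤ M`.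

What is NOT here: the subdivision (de Casteljau) identities themselves, convergence of the enclosure under
subdivision (Garloff 1986 Thm 2), sharpness at the corner coefficients.

## Mathlib search

`bernstein`, `bernstein_apply`, `bernstein_nonneg`, `bernstein.probability` (`Mathlib.Analysis.SpecialFunctions.Bernstein`);
`Fintype.prod_sum` (`∏ i, ∑ j, f i j = ∑ x, ∏ i, f i (x i)`), `Finset.prod_nonneg`, `Finset.mul_sum`, `Finset.sum_le_sum`,
`Finset.abs_sum_le_sum_abs`. Nothing on multivariate / tensor Bernstein forms or range enclosure exists in Mathlib or the tree
(`lean search 'bernstein'`: univariate approximation only — `MethodOfApproximation.lean`, `RichardsApplications.lean`).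

## References

* J. Garloff, *Convergent bounds for the range of multivariate polynomials*, in: Interval Mathematics 1985,
  LNCS 212, Springer 1986, 37–56, §2 (Bernstein form on the unit box; range enclosure by the coefficients).
  [cite: Garloff1986, §2]
* G. T. Cargo, O. Shisha, *The Bernstein form of a polynomial*, J. Res. Nat. Bur. Standards 70B (1966) 79–81
  (univariate enclosure). [cite: CargoShisha1966, Thm 1]
-/

namespace Literature.Computation.Certificates.TensorBernstein

open Finset
open scoped unitInterval

variable {κ : Type*} [Fintype κ]

/-- Tensor-product Bernstein weights `W_J(x) = Π_j B_{n_j, J_j}(x_j)` are nonnegative on the unit box.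
[cite: Garloff1986, §2] -/
theorem weight_nonneg (n : κ → ℕ) (J : (j : κ) → Fin (n j + 1)) (x : κ → I) :
    0 ≤ ∏ j, bernstein (n j) (J j) (x j) :=
  Finset.prod_nonneg fun _ _ => bernstein_nonneg

variable [DecidableEq κ]

/-- Tensor Bernstein weights sum to one at every point of the unit box (partition of unity:
`Σ_J Π_j B_{n_j,J_j}(x_j) = Π_j Σ_ν B_{n_j,ν}(x_j) = 1`). [cite: Garloff1986, §2] -/
theorem sum_weight_eq_one (n : κ → ℕ) (x : κ → I) :
    ∑ J : (j : κ) → Fin (n j + 1), ∏ j, bernstein (n j) (J j) (x j) = 1 := by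
  rw [← Fintype.prod_sum (fun j (ν : Fin (n j + 1)) => bernstein (n j) ν (x j))]
  exact Finset.prod_eq_one fun j _ => bernstein.probability (n j) (x j)

/-- A constant is the tensor Bernstein form `Σ_J b_J W_J(x)` with all coefficients equal to it.
[cite: Garloff1986, §2] -/
theorem form_const (n : κ → ℕ) (c : ℝ) (x : κ → I) :
    ∑ J : (j : κ) → Fin (n j + 1), c * ∏ j, bernstein (n j) (J j) (x j) = c := by
  rw [← Finset.mul_sum, sum_weight_eq_one, mul_one]

/-- **Range enclosure from below**: if every coefficient `b_J ≥ m`, the tensor Bernstein form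
`p(x) = Σ_J b_J W_J(x)` is `≥ m` on the whole unit box (`p(x) - m = Σ_J (b_J - m) W_J(x) ≥ 0`).
[cite: Garloff1986, §2] -/
theorem le_form_of_forall_le {n : κ → ℕ} {b : ((j : κ) → Fin (n j + 1)) → ℝ} {m : ℝ}
    (hm : ∀ J, m ≤ b J) (x : κ → I) :
    m ≤ ∑ J : (j : κ) → Fin (n j + 1), b J * ∏ j, bernstein (n j) (J j) (x j) := by
  have h : ∑ J : (j : κ) → Fin (n j + 1), m * ∏ j, bernstein (n j) (J j) (x j) ≤
      ∑ J : (j : κ) → Fin (n j + 1), b J * ∏ j, bernstein (n j) (J j) (x j) :=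
    Finset.sum_le_sum fun J _ => mul_le_mul_of_nonneg_right (hm J) (weight_nonneg n J x)
  rwa [form_const] at h

/-- **Range enclosure from above**: if every coefficient `b_J ≤ M`, the form is `≤ M` on the whole unit box.
[cite: Garloff1986, §2] -/
theorem form_le_of_forall_le {n : κ → ℕ} {b : ((j : κ) → Fin (n j + 1)) → ℝ} {M : ℝ}
    (hM : ∀ J, b J ≤ M) (x : κ → I) :
    ∑ J : (j : κ) → Fin (n j + 1), b J * ∏ j, bernstein (n j) (J j) (x j) ≤ M := by
  have h : ∑ J : (j : κ) → Fin (n j + 1), b J * ∏ j, bernstein (n j) (J j) (x j) ≤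
      ∑ J : (j : κ) → Fin (n j + 1), M * ∏ j, bernstein (n j) (J j) (x j) :=
    Finset.sum_le_sum fun J _ => mul_le_mul_of_nonneg_right (hM J) (weight_nonneg n J x)
  rwa [form_const] at h

/-- **Absolute range enclosure**: if every coefficient has `|b_J| ≤ M`, then `|p(x)| ≤ M` on the unit box (used to
price the absolute values `|p_i(w)|` of the remainder-touched coordinates in the joint-pricing floor F3).
[cite: Garloff1986, §2] -/
theorem abs_form_le_of_forall_abs_le {n : κ → ℕ} {b : ((j : κ) → Fin (n j + 1)) → ℝ} {M : ℝ}
    (hM : ∀ J, |b J| ≤ M) (x : κ → I) :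
    |∑ J : (j : κ) → Fin (n j + 1), b J * ∏ j, bernstein (n j) (J j) (x j)| ≤ M := by
  rw [abs_le]
  exact ⟨by simpa using le_form_of_forall_le (fun J => (abs_le.1 (hM J)).1) x,
    form_le_of_forall_le (fun J => (abs_le.1 (hM J)).2) x⟩

/-- The form is monotone in its coefficient vector (pointwise order). [cite: Garloff1986, §2] -/
theorem form_mono {n : κ → ℕ} {b b' : ((j : κ) → Fin (n j + 1)) → ℝ} (h : ∀ J, b J ≤ b' J) (x : κ → I) :
    ∑ J : (j : κ) → Fin (n j + 1), b J * ∏ j, bernstein (n j) (J j) (x j) ≤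
      ∑ J : (j : κ) → Fin (n j + 1), b' J * ∏ j, bernstein (n j) (J j) (x j) :=
  Finset.sum_le_sum fun J _ => mul_le_mul_of_nonneg_right (h J) (weight_nonneg n J x)

/-! ### The branch-and-bound floor a certificate reader quotes -/

/-- **Floor by leaf representations** (branch and bound over a partition): `S ⊆ X` is covered by leaves
`ℓ ∈ Λ`, each with a membership set `leaf ℓ`, a reparametrisation `φ ℓ : X → [0,1]^κ` (for a sub-box,
`x ↦ (x - lo_ℓ)/(hi_ℓ - lo_ℓ)` coordinatewise) and coefficients `b ℓ` such that `f = (Σ_J b_ℓ,J W_J) ∘ φ ℓ` on the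
leaf; if every coefficient of every leaf is `≥ m` then `m ≤ f` on `S`. The representation hypotheses are exact
polynomial identities (de Casteljau subdivision) checked by the reader. [cite: Garloff1986, §2] -/
theorem le_of_leafRepresentation {X Λ : Type*} {n : κ → ℕ} (S : Set X) (f : X → ℝ) (leaf : Λ → Set X)
    (hcover : ∀ x ∈ S, ∃ ℓ, x ∈ leaf ℓ) (φ : Λ → X → (κ → I))
    (b : Λ → ((j : κ) → Fin (n j + 1)) → ℝ)
    (hrep : ∀ ℓ, ∀ x ∈ leaf ℓ, x ∈ S →
      f x = ∑ J : (j : κ) → Fin (n j + 1), b ℓ J * ∏ j, bernstein (n j) (J j) (φ ℓ x j))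
    (m : ℝ) (hm : ∀ ℓ J, m ≤ b ℓ J) {x : X} (hx : x ∈ S) : m ≤ f x := by
  obtain ⟨ℓ, hℓ⟩ := hcover x hx
  rw [hrep ℓ x hℓ hx]
  exact le_form_of_forall_le (hm ℓ) (φ ℓ x)

/-- **Absolute bound by leaf representations**: as `le_of_leafRepresentation`, with `|b ℓ J| ≤ M` for every leaf
coefficient ⇒ `|f| ≤ M` on `S`. [cite: Garloff1986, §2] -/
theorem abs_le_of_leafRepresentation {X Λ : Type*} {n : κ → ℕ} (S : Set X) (f : X → ℝ) (leaf : Λ → Set X)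
    (hcover : ∀ x ∈ S, ∃ ℓ, x ∈ leaf ℓ) (φ : Λ → X → (κ → I))
    (b : Λ → ((j : κ) → Fin (n j + 1)) → ℝ)
    (hrep : ∀ ℓ, ∀ x ∈ leaf ℓ, x ∈ S →
      f x = ∑ J : (j : κ) → Fin (n j + 1), b ℓ J * ∏ j, bernstein (n j) (J j) (φ ℓ x j))
    (M : ℝ) (hM : ∀ ℓ J, |b ℓ J| ≤ M) {x : X} (hx : x ∈ S) : |f x| ≤ M := by
  obtain ⟨ℓ, hℓ⟩ := hcover x hx
  rw [hrep ℓ x hℓ hx]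
  exact abs_form_le_of_forall_abs_le (hM ℓ) (φ ℓ x)

/-- **Floor of `g - Σ_i B_i |p_i|` by leaf representations** (the joint-pricing floor F3 of the reader:
the smooth part `g` and each priced coordinate `p i` are represented on every leaf; the leaf value
`min_J c_ℓ,J - Σ_i B_i max_J |d_ℓ,i,J|` bounds `g - Σ_i B_i |p_i|` below on the leaf, and the least leaf value
on `S`). [cite: Garloff1986, §2] -/
theorem sub_sum_abs_ge_of_leafRepresentation {X Λ R : Type*} {n : κ → ℕ} (S : Set X) (leaf : Λ → Set X)
    (hcover : ∀ x ∈ S, ∃ ℓ, x ∈ leaf ℓ) (φ : Λ → X → (κ → I))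
    (g : X → ℝ) (c : Λ → ((j : κ) → Fin (n j + 1)) → ℝ)
    (hg : ∀ ℓ, ∀ x ∈ leaf ℓ, x ∈ S →
      g x = ∑ J : (j : κ) → Fin (n j + 1), c ℓ J * ∏ j, bernstein (n j) (J j) (φ ℓ x j))
    (Rs : Finset R) (B : R → ℝ) (hB : ∀ i ∈ Rs, 0 ≤ B i) (p : R → X → ℝ)
    (dcoef : Λ → R → ((j : κ) → Fin (n j + 1)) → ℝ)
    (hp : ∀ ℓ, ∀ i ∈ Rs, ∀ x ∈ leaf ℓ, x ∈ S →
      p i x = ∑ J : (j : κ) → Fin (n j + 1), dcoef ℓ i J * ∏ j, bernstein (n j) (J j) (φ ℓ x j))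
    (cmin : Λ → ℝ) (hcmin : ∀ ℓ J, cmin ℓ ≤ c ℓ J)
    (dmax : Λ → R → ℝ) (hdmax : ∀ ℓ, ∀ i ∈ Rs, ∀ J, |dcoef ℓ i J| ≤ dmax ℓ i)
    (m : ℝ) (hm : ∀ ℓ, m ≤ cmin ℓ - ∑ i ∈ Rs, B i * dmax ℓ i) {x : X} (hx : x ∈ S) :
    m ≤ g x - ∑ i ∈ Rs, B i * |p i x| := by
  obtain ⟨ℓ, hℓ⟩ := hcover x hx
  have h1 : cmin ℓ ≤ g x := by
    rw [hg ℓ x hℓ hx]; exact le_form_of_forall_le (hcmin ℓ) (φ ℓ x)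
  have h2 : ∑ i ∈ Rs, B i * |p i x| ≤ ∑ i ∈ Rs, B i * dmax ℓ i := by
    refine Finset.sum_le_sum fun i hi => mul_le_mul_of_nonneg_left ?_ (hB i hi)
    rw [hp ℓ i hi x hℓ hx]; exact abs_form_le_of_forall_abs_le (hdmax ℓ i hi) (φ ℓ x)
  linarith [hm ℓ]

end Literature.Computation.Certificates.TensorBernstein
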